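import Summits.CriticalPhenomena.CardyFormulaZ2.Theorems.CardyAnchoredRigidityCardyShadowIsolatedButlerWaltmanUnstable
import HarnessLib

/-!
# Crux `CardyShadowIsolated` (stmt-CriticalPhenomena-5767), line `dilation-dynamics`:
# Butler–Waltman lemma for product-space ω-limit sets — stable half (registered stub `stub_butlerWaltmanStable`)

Time reversal of `…ButlerWaltmanUnstable.lean` (same setting and notation): if the fixed point
`g ∈ Λ` is an isolated invariant set of the ω-limit set `Λ` and no other point of `Λ` tends to `g`
in FORWARD time, then `Λ = {g}`. The entrance points of the long sojourns of the orbit in a box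
around `g` accumulate at a point `z ∈ Λ`, `z ≠ g`, whose forward orbit stays in the box, so its
ω-limit set is an invariant subset of the box, i.e. `{g}`.
-/

namespace Summit.CriticalPhenomena.CardyFormulaZ2.Theorems.CardyShadowIsolated.DilationDynamics

open Set Filter Topology

section ButlerWaltman

variable {ι : Type*} (T : ℝ → ι → ι) (x : ℝ → ι → ℝ)

/-- **Entrance lemma** (time reversal of `exists_exit_point`). A time `v₀` outside the closed box
followed by a sojourn in the box during `[s, s + L]` (`v₀ ≤ s`) produces a time
`τ ≤ s + κ` from which on the orbit stays in the box until `s + L` and at which it is already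
`ε i / 2`-far from `g` in some coordinate `i ∈ I`. [folklore] -/
theorem exists_entrance_point
    (I : Finset ι) (ε : ι → ℝ) (g : ι → ℝ)
    {κ : ℝ} (hκ : 0 < κ) {S v₀ s L : ℝ}
    (hS : ∀ i ∈ I, ∀ s', S ≤ s' → ∀ u ∈ Icc (0 : ℝ) κ, |x (s' + u) i - x s' i| < ε i / 4)
    (hSv : S + κ ≤ v₀) (hvs : v₀ ≤ s)
    (hsoj : ∀ t ∈ Icc s (s + L), ∀ i ∈ I, |x t i - g i| ≤ ε i)
    (hv : ∃ i ∈ I, ε i < |x v₀ i - g i|) :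
    ∃ τ, v₀ ≤ τ ∧ τ ≤ s + κ ∧ (∀ t ∈ Icc τ (s + L), ∀ i ∈ I, |x t i - g i| ≤ ε i) ∧
      ∃ i ∈ I, ε i / 2 ≤ |x τ i - g i| := by
  set A : Set ℝ := {ρ | v₀ ≤ ρ ∧ ρ ≤ s ∧ ∀ t ∈ Icc ρ (s + L), ∀ i ∈ I, |x t i - g i| ≤ ε i} with hA
  have hmem : s ∈ A := ⟨hvs, le_rfl, hsoj⟩
  have hne : A.Nonempty := ⟨_, hmem⟩
  have hbdd : BddBelow A := ⟨v₀, fun ρ hρ => hρ.1⟩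
  set ρ := sInf A with hρ
  have h1 : ρ ≤ s := csInf_le hbdd hmem
  have h2 : v₀ ≤ ρ := le_csInf hne fun ρ' h => h.1
  have hin : ∀ t, ρ < t → t ≤ s + L → ∀ i ∈ I, |x t i - g i| ≤ ε i := by
    intro t hρt hts
    obtain ⟨ρ', hρ'A, hρ't⟩ := exists_lt_of_csInf_lt hne hρt
    exact hρ'A.2.2 t ⟨hρ't.le, hts⟩
  have hout : ∃ t, ρ - κ / 2 ≤ t ∧ t ≤ ρ ∧ ∃ i ∈ I, ε i < |x t i - g i| := by
    by_cases hvρ : ρ - κ / 2 ≤ v₀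
    · exact ⟨v₀, hvρ, h2, hv⟩
    · push Not at hvρ
      have hnot : ρ - κ / 2 ∉ A := fun h => by
        have := csInf_le hbdd h
        linarith
      have hnot' : ¬ ∀ t ∈ Icc (ρ - κ / 2) (s + L), ∀ i ∈ I, |x t i - g i| ≤ ε i := fun h =>
        hnot ⟨hvρ.le, by linarith, h⟩
      push Not at hnot'
      obtain ⟨t, ht, i, hi, hlt⟩ := hnot'
      refine ⟨t, ht.1, ?_, i, hi, hlt⟩
      by_contra htρ
      push Not at htρ
      exact absurd (hin t htρ ht.2 i hi) (not_le.2 hlt)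
  obtain ⟨tout, h3, h4, i, hi, hfar⟩ := hout
  refine ⟨ρ + κ / 2, by linarith, by linarith,
    fun t ht j hj => hin t (by linarith [ht.1]) ht.2 j hj, i, hi, ?_⟩
  have hc := hS i hi tout (by linarith) (ρ + κ / 2 - tout) ⟨by linarith, by linarith⟩
  have heq : tout + (ρ + κ / 2 - tout) = ρ + κ / 2 := by ring
  rw [heq] at hc
  have hle := abs_sub_abs_le_abs_sub (x tout i - g i) (x (ρ + κ / 2) i - g i)
  have hsimp : x tout i - g i - (x (ρ + κ / 2) i - g i) = x tout i - x (ρ + κ / 2) i := by ring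
  rw [hsimp] at hle
  rw [abs_sub_comm] at hc
  have h0 := abs_nonneg (x tout i - x (ρ + κ / 2) i)
  linarith

/-- **Butler–Waltman, stable half, for product-space ω-limit sets**: as
`eq_of_isolatedInvariant_of_unstableTrivial`, with the triviality of the STABLE set of `g` in `Λ`
(no `h ∈ Λ`, `h ≠ g`, tends to `g` as `t → +∞`) in place of the unstable one. The entrance points
of the long sojourns accumulate at a point `z ∈ Λ`, `z ≠ g`, whose forward orbit stays in the
box, so its ω-limit set is `{g}`. [cite: ButlerWaltman1986, Lemma A1; SmithThieme2011, Lemma 8.17] -/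
theorem eq_of_isolatedInvariant_of_stableTrivial
    (hgrp : ∀ s t i, x (s + t) i = x s (T t i))
    (hT : ∀ u t i, T u (T t i) = T (u + t) i)
    {K : Set (ι → ℝ)} (hK : IsCompact K) (hxK : ∀ s, x s ∈ K)
    (hcont : ∀ i, ∀ ε > (0 : ℝ), ∃ κ > (0 : ℝ), ∃ S : ℝ, ∀ s, S ≤ s →
      ∀ u ∈ Icc (0 : ℝ) κ, |x (s + u) i - x s i| < ε)
    {g : ι → ℝ} (hfix : ∀ t i, g (T t i) = g i) (hg : MapClusterPt g atTop x)
    (hC : ∃ N ∈ 𝓝 g, ∀ h : ι → ℝ, MapClusterPt h atTop x →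
      (∀ t : ℝ, (fun i => h (T t i)) ∈ N) → h = g)
    (hE : ∀ h : ι → ℝ, MapClusterPt h atTop x →
      Tendsto (fun (t : ℝ) (i : ι) => h (T t i)) atTop (𝓝 g) → h = g) :
    ∀ h : ι → ℝ, MapClusterPt h atTop x → h = g := by
  classical
  intro g' hg'
  by_contra hne
  have hex : ∃ i₀, g' i₀ ≠ g i₀ := by
    by_contra h
    push Not at h
    exact hne (funext h)
  obtain ⟨i₀, hi₀⟩ := hex
  set d : ℝ := |g' i₀ - g i₀| / 2 with hd
  have hdpos : 0 < d := by
    have := abs_pos.2 (sub_ne_zero.2 hi₀)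
    rw [hd]
    linarith
  obtain ⟨N, hN, hiso⟩ := hC
  rw [nhds_pi] at hN
  obtain ⟨I₁, tN, htN, hts⟩ := Filter.mem_pi'.1 hN
  choose ε₁ hε₁ hball using fun i => Metric.nhds_basis_closedBall.mem_iff.1 (htN i)
  set I : Finset ι := insert i₀ I₁ with hI
  set ε : ι → ℝ := fun i => min (ε₁ i) d with hεdef
  have hε : ∀ i, 0 < ε i := fun i => lt_min (hε₁ i) hdpos
  have hεd : ∀ i, ε i ≤ d := fun i => min_le_right _ _
  have hboxN : ∀ h : ι → ℝ, (∀ i ∈ I, |h i - g i| ≤ ε i) → h ∈ N := by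
    intro h hh
    apply hts
    refine Set.mem_pi.2 fun i hi => hball i ?_
    rw [Metric.mem_closedBall, Real.dist_eq]
    exact (hh i (Finset.mem_insert_of_mem (Finset.mem_coe.1 hi))).trans (min_le_left _ _)
  obtain ⟨κ, hκ, S, hS⟩ :=
    tail_continuity_finset x hcont I (fun i => ε i / 4) (fun i => by linarith [hε i])
  have hexit : ∀ S₁ : ℝ, ∃ v, S₁ ≤ v ∧ ε i₀ < |x v i₀ - g i₀| := by
    intro S₁
    have hV : (fun h : ι → ℝ => h i₀) ⁻¹' Metric.ball (g' i₀) (d / 2) ∈ 𝓝 g' :=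
      (continuous_apply i₀).continuousAt.preimage_mem_nhds (Metric.ball_mem_nhds _ (by positivity))
    obtain ⟨v, hv, hSv⟩ :=
      (((mapClusterPt_iff_frequently.1 hg') _ hV).and_eventually (eventually_ge_atTop S₁)).exists
    refine ⟨v, hSv, ?_⟩
    rw [mem_preimage, Metric.mem_ball, Real.dist_eq] at hv
    have h2d : |g' i₀ - g i₀| = 2 * d := by rw [hd]; ring
    have hle := abs_sub_abs_le_abs_sub (g' i₀ - g i₀) (g' i₀ - x v i₀)
    have hs' : g' i₀ - g i₀ - (g' i₀ - x v i₀) = x v i₀ - g i₀ := by ring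
    rw [hs'] at hle
    have hb : |g' i₀ - x v i₀| < d / 2 := by rw [abs_sub_comm]; exact hv
    linarith [hεd i₀]
  -- the entrance points: `z n = x (τ n)`, far from `g`, forward orbit in the box during `[0, n]`
  have hstep : ∀ n : ℕ, ∃ τ : ℝ, (n : ℝ) ≤ τ ∧
      (∀ u ∈ Icc (0 : ℝ) n, ∀ i ∈ I, |x (τ + u) i - g i| ≤ ε i) ∧
      ∃ i ∈ I, ε i / 2 ≤ |x τ i - g i| := by
    intro n
    set m : ℕ := ⌈((n : ℝ) + κ) / κ⌉₊ with hm
    have hLge : (n : ℝ) + κ ≤ m * κ := by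
      have h1 : ((n : ℝ) + κ) / κ ≤ m := Nat.le_ceil _
      rw [div_le_iff₀ hκ] at h1
      exact h1
    obtain ⟨v₀, hv1, hv2⟩ := hexit (max (S + κ) n)
    obtain ⟨s, hs₀, hsS, hsoj⟩ :=
      exists_long_sojourn T x hgrp hfix hg I ε hε hκ hS m v₀
    obtain ⟨τ, hτ1, hτ2, hin, i, hi, hfar⟩ :=
      exists_entrance_point x I ε g hκ hS (le_trans (le_max_left _ _) hv1) hs₀
        (fun t ht i hi => (hsoj t ht i hi).le.trans (by linarith [hε i]))
        ⟨i₀, Finset.mem_insert_self _ _, hv2⟩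
    have hnv : (n : ℝ) ≤ v₀ := le_trans (le_max_right _ _) hv1
    refine ⟨τ, by linarith, fun u hu i hi => hin (τ + u) ⟨by linarith [hu.1], ?_⟩ i hi, i, hi, hfar⟩
    have := hu.2
    linarith
  choose τ hτn hfwd hfar using hstep
  have hzK : Filter.map (fun n : ℕ => x (τ n)) atTop ≤ 𝓟 K := by
    rw [Filter.le_principal_iff, Filter.mem_map]
    exact Eventually.of_forall fun n => hxK _
  obtain ⟨z, -, hz⟩ := hK.exists_mapClusterPt hzK
  have hzΛ : MapClusterPt z atTop x := by
    have hτ : Tendsto τ atTop atTop := tendsto_atTop_mono hτn tendsto_natCast_atTop_atTop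
    exact MapClusterPt.of_comp hτ hz
  have hbox_closed : IsClosed {h : ι → ℝ | ∀ i ∈ I, |h i - g i| ≤ ε i} := by
    have heq : {h : ι → ℝ | ∀ i ∈ I, |h i - g i| ≤ ε i} = ⋂ i ∈ I, {h | |h i - g i| ≤ ε i} := by
      ext h
      simp only [mem_setOf_eq, mem_iInter]
    rw [heq]
    exact isClosed_biInter fun i _ =>
      isClosed_le ((continuous_apply i).sub continuous_const).abs continuous_const
  have hfar_closed : IsClosed {h : ι → ℝ | ∃ i ∈ I, ε i / 2 ≤ |h i - g i|} := by
    have heq : {h : ι → ℝ | ∃ i ∈ I, ε i / 2 ≤ |h i - g i|} = ⋃ i ∈ I, {h | ε i / 2 ≤ |h i - g i|} := by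
      ext h
      simp only [mem_setOf_eq, mem_iUnion, exists_prop]
    rw [heq]
    exact isClosed_biUnion_finset fun i _ =>
      isClosed_le continuous_const ((continuous_apply i).sub continuous_const).abs
  -- the forward orbit of `z` stays in the box
  have hzfwd : ∀ u : ℝ, 0 ≤ u → ∀ i ∈ I, |z (T u i) - g i| ≤ ε i := by
    intro u hu
    have hc : Continuous fun (k : ι → ℝ) (i : ι) => k (T u i) :=
      continuous_pi fun i => continuous_apply (T u i)
    have h1 : MapClusterPt (fun i => z (T u i)) atTop
        ((fun (k : ι → ℝ) (i : ι) => k (T u i)) ∘ fun n => x (τ n)) :=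
      hz.continuousAt_comp hc.continuousAt
    have h2 : ∀ᶠ n : ℕ in atTop, ((fun (k : ι → ℝ) (i : ι) => k (T u i)) ∘ fun n => x (τ n)) n ∈
        {h : ι → ℝ | ∀ i ∈ I, |h i - g i| ≤ ε i} := by
      filter_upwards [eventually_ge_atTop ⌈u⌉₊] with n hn
      simp only [Function.comp_apply]
      intro i hi
      rw [← hgrp]
      have hn' : (⌈u⌉₊ : ℝ) ≤ n := by exact_mod_cast hn
      exact hfwd n u ⟨hu, by linarith [Nat.le_ceil u]⟩ i hi
    exact hbox_closed.mem_of_mapClusterPt h1 h2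
  have hzfar : z ∈ {h : ι → ℝ | ∃ i ∈ I, ε i / 2 ≤ |h i - g i|} :=
    hfar_closed.mem_of_mapClusterPt hz (Eventually.of_forall fun n => hfar n)
  have hzne : z ≠ g := by
    rintro rfl
    obtain ⟨i, -, h⟩ := hzfar
    simp only [sub_self, abs_zero] at h
    linarith [hε i]
  have hΛK : ∀ h : ι → ℝ, MapClusterPt h atTop x → h ∈ K := fun h hh =>
    hK.isClosed.mem_of_mapClusterPt hh (Eventually.of_forall hxK)
  -- every ω-limit point `w` of `z` has its whole orbit in the box, hence is `g`
  have huniq : ∀ w : ι → ℝ, MapClusterPt w atTop (fun (u : ℝ) (i : ι) => z (T u i)) → w = g := by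
    intro w hw
    have hwΛ : MapClusterPt w atTop x :=
      isClosed_setOf_clusterPt.mem_of_mapClusterPt hw
        (Eventually.of_forall fun u => mapClusterPt_comp_of_orbit T x hgrp hzΛ u)
    refine hiso w hwΛ fun t => hboxN _ ?_
    have hc : Continuous fun (k : ι → ℝ) (i : ι) => k (T t i) :=
      continuous_pi fun i => continuous_apply (T t i)
    have h1 : MapClusterPt (fun i => w (T t i)) atTop
        ((fun (k : ι → ℝ) (i : ι) => k (T t i)) ∘ fun (u : ℝ) (i : ι) => z (T u i)) :=
      hw.continuousAt_comp hc.continuousAt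
    have h2 : ((fun (k : ι → ℝ) (i : ι) => k (T t i)) ∘ fun (u : ℝ) (i : ι) => z (T u i)) =
        (fun (u : ℝ) (i : ι) => z (T u i)) ∘ fun u => u + t := by
      funext u i
      simp only [Function.comp_apply]
      rw [hT]
    rw [h2] at h1
    have h3 : MapClusterPt (fun i => w (T t i)) atTop (fun (u : ℝ) (i : ι) => z (T u i)) :=
      MapClusterPt.of_comp (tendsto_atTop_add_const_right _ _ tendsto_id) h1
    exact hbox_closed.mem_of_mapClusterPt h3 (by
      filter_upwards [eventually_ge_atTop (0 : ℝ)] with u hu using hzfwd u hu)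
  have htend : Tendsto (fun (u : ℝ) (i : ι) => z (T u i)) atTop (𝓝 g) :=
    hK.tendsto_nhds_of_unique_mapClusterPt
      (Eventually.of_forall fun u => hΛK _ (mapClusterPt_comp_of_orbit T x hgrp hzΛ u))
      fun w _ hw => huniq w hw
  exact hzne (hE z hzΛ htend)

end ButlerWaltman

/-- **Registered stub `stub_butlerWaltmanStable`** of the lead's skeleton (line `dilation-dynamics`):
`eq_of_isolatedInvariant_of_stableTrivial` in closed form. [cite: ButlerWaltman1986, Lemma A1] -/
theorem stub_butlerWaltmanStable : ∀ (ι : Type) (T : ℝ → ι → ι) (x : ℝ → ι → ℝ), (∀ s t i, x (s + t) i = x s (T t i)) → (∀ u t i, T u (T t i) = T (u + t) i) → ∀ (K : Set (ι → ℝ)), IsCompact K → (∀ s, x s ∈ K) → (∀ i, ∀ ε > (0 : ℝ), ∃ κ > (0 : ℝ), ∃ S : ℝ, ∀ s, S ≤ s → ∀ u ∈ Set.Icc (0 : ℝ) κ, |x (s + u) i - x s i| < ε) → ∀ (g : ι → ℝ), (∀ t i, g (T t i) = g i) → MapClusterPt g Filter.atTop x → (∃ N ∈ nhds g, ∀ h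 : ι → ℝ, MapClusterPt h Filter.atTop x → (∀ t : ℝ, (fun i => h (T t i)) ∈ N) → h = g) → (∀ h : ι → ℝ, MapClusterPt h Filter.atTop x → Filter.Tendsto (fun (t : ℝ) (i : ι) => h (T t i)) Filter.atTop (nhds g) → h = g) → ∀ h : ι → ℝ, MapClusterPt h Filter.atTop x → h = g :=
  fun _ T x hgrp hT _ hK hxK hcont _ hfix hg hC hE =>
    eq_of_isolatedInvariant_of_stableTrivial T x hgrp hT hK hxK hcont hfix hg hC hE

end Summit.CriticalPhenomena.CardyFormulaZ2.Theorems.CardyShadowIsolated.DilationDynamics
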